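import Literature.MathematicalPhysics.QuantumFieldTheory.Balaban1983to89.B6Ineq2134DiagKLevelTorus
import Literature.MathematicalPhysics.QuantumFieldTheory.Balaban1983to89.B6Ineq2134KFamKLevel

/-!
# `Balaban1983to89.B6Ineq2134KFamKLevelTorus` — T. Bałaban, *Propagators and renormalization transformations for lattice gauge theories. II*,
# Commun. Math. Phys. **96** (1984) 223–250 [Balaban1984PropagatorsII], (2.134) p. 247 FOR THE WHOLE KERNEL FAMILY `K_{□,□′}` OF (2.91)–(2.93) ON THE
# GENUINE MULTI-LEVEL TORUS: the hypotheses `h2134` + `hsmall` of `…B6Prop26Gluing.majorant_R_of_2134` / r03's `B6GlobalChartV1.prop26_2136_V1_of_2134_eq291`,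
# for all pairs, ONE `θ₀ = Θ·(C_PC_G/m + U)/M`, ONE rate — the torus twin of `…B6Ineq2134KFamKLevel` (file 3 of the torus port; `∂P∂*` a displayed hypothesis)

statement-level skeleton of published theorems with citation tags; proofs where landed; nothing here is a claim about the Yang–Mills mass gap

PDF held: `paper:balaban1984-cmp96-propagators-rt-ii` (journal page = PDF page + 222): p. 239 [PDF 17] ((2.91)–(2.93)), p. 247 [PDF 25] ((2.134)–(2.135)); read
from the tree transcriptions (`…B6Eq291Generator`, `…B6Prop26Gluing`).  PRINT p. 247 (verbatim): *"|(K_{□,□′}G_{□′}h_{□′}J)(x)| ≤ O(M⁻¹)e^{−½δ₂d(y,y′)}|J|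
(2.134) for x ∈ Δ(y), supp J ⊂ Δ(y′), and this together with (2.91) implies |(RJ)(x)| ≤ O(M⁻¹)e^{−½δ₂d(y,y′)}|J|, x ∈ Δ(y), supp J ⊂ Δ(y′). (2.135)"*.
READING (ours): `θ₀` below is OUR NAME for print's prefactor O(M⁻¹) of (2.134)/(2.135) — print has no symbol θ₀ (referee ref-1 g77, F1; ref-4 N-B6-g59-1).

CITATION HEADER (lean-in-tree rule) — WHAT IS REPRODUCED.  Phase-2 file of the `lit-balaban` typed skeleton (HOME `run/shared/lean/pub/lit-balaban/`), seat
**p38 gen 25**; B6-CLOSURE §5 item 9 (torus port of the (2.134) inputs for ROUTE V), file 3; SKELETON rows **B6.Eq2.134** × **B6.Eq2.91** × **B6.Prop2.6**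
(cells only; decls of record untouched; referee ref-4).  Files 1–2 of the port (`…B6Ineq2134KLevelTorus`, `…B6Ineq2134DiagKLevelTorus`) give the
off-diagonal and diagonal (2.134) on B8's `geomTB D`; THIS FILE joins them exactly as the box file `…B6Ineq2134KFamKLevel` (p343147) did, for every nested
family `D : TDomains d ℓ M_h k P R` on the torus (`M_h ≥ 1`, `P_μ ≥ 1`, `R ≥ 2L`, `L·M_h ≥ M₀`), every fine lattice `X` with block map `blk`, every
candidate `Dg` for the global `∂P∂*` with the (2.88)-shape majorant `C_P(L^j)^{−2}e^{−δ_Gd}` (hypothesis `hDg`):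
* **`h2134_kFam_torus`**: for all `(□, □′) ∈ 𝒟²`, `HasMajorant blk ((kFam Dg h ζ M P □ □′·G_□′)·h_□′) (θ₀·e^{−(δ_G/2)d})`, **`θ₀ = Θ·(C_PC_G/m + U)/M`**,
  `U = n_E·s₁C₁ + s₂C_G + (n_K+1)·s·((C_N+1)C_G(1+r₀)) + C_DC_G/c_D`, under the per-cube data of the box file verbatim;
* **`inputs2134_kFam_torus`**: the same together with `N²θ₀c₁ < 1` above ONE threshold (the box file's `theta0_joint_lt` by name); `hR` := `rOp_eq_sum`,
  `hKout` := `outLoc_kFam` (box file, generic, by name).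
No `def`, no new fact; standard axioms.
HONEST SCOPE. As the box file and files 1–2 of the port (per-cube inputs displayed; `∂P∂*` a hypothesis; lattice units `η = 1`; constants `L`-dependent,
`k`/`M_h`-independent); integer torus; nothing on d = 4 or the continuum; NOT summit progress.  Unit `lit-balaban-p38` (gen 25), 2026-08-23.
-/

namespace Literature.MathematicalPhysics.QuantumFieldTheory.Balaban1983to89.B6Ineq2134KFamKLevelTorus

open Literature.MathematicalPhysics.QuantumFieldTheory.Balaban1983to89.B6MultiLevelTorusOperator (TDomains)
open Literature.MathematicalPhysics.QuantumFieldTheory.Balaban1983to89.B8Ineq192MultiLevelTorus (geomTB geomTB_M)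
open Literature.MathematicalPhysics.QuantumFieldTheory.Balaban1983to89.B6RandomWalk (HasMajorant hasMajorant_mono)
open Literature.MathematicalPhysics.QuantumFieldTheory.Balaban1983to89.B6Prop26Gluing (mulOp mulOp_apply LocalMajorant OutLoc)
open Literature.MathematicalPhysics.QuantumFieldTheory.Balaban1983to89.B6Ineq2134KLevelTorus (M_pos_TB ineq2134_kOff_torus)
open Literature.MathematicalPhysics.QuantumFieldTheory.Balaban1983to89.B6Ineq2134DiagKLevelTorus (ineq2134_kDiag_torus_theta)
open Literature.MathematicalPhysics.QuantumFieldTheory.Balaban1983to89.B6Ineq2134KFamKLevel (theta0_joint_lt)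
open Literature.MathematicalPhysics.QuantumFieldTheory.Balaban1983to89.B6Eq291Generator (kDiag kOff kFam)

variable {d ℓ : ℕ}

/-- a local majorant restricts to a smaller reach set. [folklore] -/
private theorem localMajorant_subset {g : B6.Geometry} {X : Type} (blk : X → g.Site) {T : Module.End ℝ (X → ℝ)} {S S' : Set g.Site}
    {K : g.Site → g.Site → ℝ} (h : LocalMajorant blk T S K) (hS : S' ⊆ S) : LocalMajorant blk T S' K :=
  fun y' hy' μ B hμ x hx => h y' (hS hy') μ B hμ x (hS hx)

/-! ## §1  `h2134` for ALL pairs of the (2.91) family on the torus -/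

/-- **(2.134) FOR THE WHOLE FAMILY `K_{□,□′}` OF (2.91) ON THE GENUINE MULTI-LEVEL TORUS, ONE `θ₀ = O(M⁻¹)` AND ONE RATE FOR ALL PAIRS** (torus twin of `…B6Ineq2134KFamKLevel.h2134_kFam_kLevel`; the global `∂P∂*` a displayed hypothesis `hDg`, any fine lattice `X`).  For every rate `δ_G > 0`
there are `M₀`, `Θ ≥ 0` (on `d, L, δ_G` only) such that for every nested family on the torus with `L·M_h ≥ M₀`, constants `C_G, C₁, C_N, C_D, s, s₁, s₂, r₀ ≥ 0`,
`c_D, m > 0`, sizes `n_E, n_K` and every cube family `𝒟` with per-cube data — `G_□` (on the fine lattice `X`; the (2.133)-shape pair `C_G(L^jη)²e^{−δ_Gd}` /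
`C₁(L^jη)e^{−δ_Gd}` on the window `T_□`, output-localised to `T_□`), `h_□` (`|h_□| ≤ 1`, supported within the blocks of `S_□ ⊆ T_□`, block-Lipschitz
`(s/M)(d + r₀)`), `ζ_□` (`0 ≤ ζ_□ ≤ 1`, `= 1` on the blocks of the core `Score_□`), the gap `m·M ≤ d(y, y″)` for `y ∉ Score_□`, `y″ ∈ S_□`, the decomposition of
`h_□M_□ − M_□h_□` into line 1 (`Σ_e c_{□,e}E_{□,e} − c_{□,0}`, `|c_{□,e}| ≤ s₁/(ML^jη)`, `|c_{□,0}| ≤ s₂/(M(L^jη)²)`, supported over `T_□`, `#E ≤ n_E`) + line 2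
(`Σ_k z_{□,k}[N_{□,k}, h_□]`-terms, `|z| ≤ 1`, (2.88)-shape majorants `C_N(L^jη)^{−2}e^{−δ_Gd}`, `#K ≤ n_K`), the own projection `∂P_□∂* =: P_□` (same shape) and
line 3 `ζ_□(∂P∂* − ∂P_□∂*)h_□` (`C_De^{−c_DM}(L^jη)^{−2}e^{−δ_Gd}`) — FOR ALL (□, □′) ∈ 𝒟²:
`HasMajorant blk ((kFam (∂P∂*) h ζ M P □ □′·G_□′)·h_□′) (θ₀·e^{−(δ_G/2)d(y,y′)})`, **`θ₀ = Θ·(C_PC_G/m + U)/M`**,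
`U = n_E·s₁C₁ + s₂C_G + (n_K+1)·s·((C_N+1)C_G(1+r₀)) + C_DC_G/c_D` — the hypothesis `h2134` of `…B6Prop26Gluing.majorant_R_of_2134`, pair by pair.
[cite: Balaban1984PropagatorsII, (2.134) p.247; (2.91)–(2.93) p.239; (2.88) p.238] -/
theorem h2134_kFam_torus (d ℓ : ℕ) {δG : ℝ} (hδG : 0 < δG) :
    ∃ M₀ Θ : ℝ, 0 < M₀ ∧ 0 ≤ Θ ∧
      ∀ {Mh k R : ℕ} {P : Fin (d + 1) → ℕ} (D : TDomains d ℓ Mh k P R), 1 ≤ Mh → (∀ μ, 1 ≤ P μ) → 2 * (ℓ + 1) ≤ R →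
        M₀ ≤ ((ℓ : ℝ) + 1) * Mh → ∀ {X : Type} (blk : X → (geomTB D).Site) {Dg : Module.End ℝ (X → ℝ)} {CP : ℝ}, 0 ≤ CP →
        HasMajorant blk Dg (fun y y'' => CP / (geomTB D).len y ^ 2 * Real.exp (-(δG * (geomTB D).dist y y''))) →
        ∀ {CG C₁ CN CD cD s s₁ s₂ r₀ m : ℝ}, 0 ≤ CG → 0 ≤ C₁ → 0 ≤ CN → 0 ≤ CD → 0 < cD → 0 ≤ s → 0 ≤ s₁ → 0 ≤ s₂ → 0 ≤ r₀ → 0 < m →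
        ∀ (nE nK : ℕ) {C : Type} [DecidableEq C] (Dc : Finset C) {G Ml Pl : C → Module.End ℝ (X → ℝ)} {h ζ c₀ : C → X → ℝ}
          {T S Score : C → Set (geomTB D).Site}
          {ι : Type} {DE : C → Finset ι} {E : C → ι → Module.End ℝ (X → ℝ)} {cf : C → ι → X → ℝ}
          {κ : Type} {DK : C → Finset κ} {N : C → κ → Module.End ℝ (X → ℝ)} {z : C → κ → X → ℝ},
          (∀ c ∈ Dc, (DE c).card ≤ nE) → (∀ c ∈ Dc, (DK c).card ≤ nK) →
          (∀ c ∈ Dc, mulOp (h c) * Ml c - Ml c * mulOp (h c) =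
            (∑ e ∈ DE c, mulOp (cf c e) * E c e - mulOp (c₀ c)) + ∑ k ∈ DK c, mulOp (z c k) * (N c k * mulOp (h c) - mulOp (h c) * N c k)) →
          (∀ c ∈ Dc, LocalMajorant blk (G c) (T c) (fun y y' => CG * (geomTB D).len y ^ 2 * Real.exp (-(δG * (geomTB D).dist y y')))) →
          (∀ c ∈ Dc, OutLoc blk (G c) (T c)) →
          (∀ c ∈ Dc, ∀ e ∈ DE c,
            LocalMajorant blk (E c e * G c) (T c) (fun y y' => C₁ * (geomTB D).len y * Real.exp (-(δG * (geomTB D).dist y y')))) →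
          (∀ c ∈ Dc, ∀ e ∈ DE c, ∀ x, |cf c e x| ≤ s₁ / ((geomTB D).M * (geomTB D).len (blk x))) →
          (∀ c ∈ Dc, ∀ e ∈ DE c, ∀ x, cf c e x ≠ 0 → blk x ∈ T c) →
          (∀ c ∈ Dc, ∀ x, |c₀ c x| ≤ s₂ / ((geomTB D).M * (geomTB D).len (blk x) ^ 2)) → (∀ c ∈ Dc, ∀ x, c₀ c x ≠ 0 → blk x ∈ T c) →
          (∀ c ∈ Dc, ∀ x, |h c x| ≤ 1) → (∀ c ∈ Dc, ∀ x, h c x ≠ 0 → blk x ∈ S c) → (∀ c ∈ Dc, S c ⊆ T c) →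
          (∀ c ∈ Dc, ∀ x x', |h c x' - h c x| ≤ s / (geomTB D).M * ((geomTB D).dist (blk x) (blk x') + r₀)) →
          (∀ c ∈ Dc, ∀ k ∈ DK c,
            HasMajorant blk (N c k) (fun y y'' => CN / (geomTB D).len y ^ 2 * Real.exp (-(δG * (geomTB D).dist y y'')))) →
          (∀ c ∈ Dc, ∀ k ∈ DK c, ∀ x, |z c k x| ≤ 1) →
          (∀ c ∈ Dc, HasMajorant blk (Pl c) (fun y y'' => CN / (geomTB D).len y ^ 2 * Real.exp (-(δG * (geomTB D).dist y y'')))) →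
          (∀ c ∈ Dc, ∀ x, 0 ≤ ζ c x) → (∀ c ∈ Dc, ∀ x, ζ c x ≤ 1) → (∀ c ∈ Dc, ∀ x, ζ c x ≠ 1 → blk x ∉ Score c) →
          (∀ c ∈ Dc, HasMajorant blk (mulOp (ζ c) * (Dg - Pl c) * mulOp (h c))
            (fun y y'' => CD * Real.exp (-(cD * (geomTB D).M)) / (geomTB D).len y ^ 2 * Real.exp (-(δG * (geomTB D).dist y y'')))) →
          (∀ c ∈ Dc, ∀ y y'', y ∉ Score c → y'' ∈ S c → m * (geomTB D).M ≤ (geomTB D).dist y y'') →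
          ∀ c ∈ Dc, ∀ c' ∈ Dc,
            HasMajorant blk
              ((kFam Dg (fun c => mulOp (h c)) (fun c => mulOp (ζ c)) Ml Pl c c' * G c') * mulOp (h c'))
              (fun y y' => Θ * (CP * CG / m + (nE * (s₁ * C₁) + s₂ * CG + (nK + 1) * s * ((CN + 1) * CG * (1 + r₀)) + CD * CG / cD)) *
                ((geomTB D).M)⁻¹ * Real.exp (-(δG / 2 * (geomTB D).dist y y'))) := by
  obtain ⟨M₁, Θ₁, hM₁, hΘ₁, hoff⟩ := ineq2134_kOff_torus d ℓ hδG
  obtain ⟨M₂, Θ₂, hM₂, hΘ₂, hdiag⟩ := ineq2134_kDiag_torus_theta d ℓ hδG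
  refine ⟨max M₁ M₂, max Θ₁ Θ₂, lt_max_of_lt_left hM₁, le_max_of_le_left hΘ₁, ?_⟩
  intro Mh k R P D hMh hP hR hM X blk Dg CP hCP hDg CG C₁ CN CD cD s s₁ s₂ r₀ m hCG hC₁ hCN hCD hcD hs hs₁ hs₂ hr₀ hm nE nK C _ Dc G Ml Pl h ζ c₀
    T S Score ι DE E cf κ DK N z hnE hnK hdec hG hGout hEG hcf hcfT hc₀ hc₀T hh1 hhS hST hLip hN hz hPl hζ0 hζ1 hζS hD3 hgap c hc c' hc'
  have hMi1 : M₁ ≤ ((ℓ : ℝ) + 1) * Mh := (le_max_left _ _).trans hM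
  have hMi2 : M₂ ≤ ((ℓ : ℝ) + 1) * Mh := (le_max_right _ _).trans hM
  have hMpos : 0 < (geomTB D).M := M_pos_TB D hMh
  have hMinv : 0 ≤ ((geomTB D).M)⁻¹ := inv_nonneg.2 hMpos.le
  set U : ℝ := nE * (s₁ * C₁) + s₂ * CG + (nK + 1) * s * ((CN + 1) * CG * (1 + r₀)) + CD * CG / cD with hU
  have hUnn : 0 ≤ U := by rw [hU]; positivity
  have hCGm : 0 ≤ CP * CG / m := div_nonneg (mul_nonneg hCP hCG) hm.le
  -- the common kernel dominates both packs
  have hdom : ∀ {θ : ℝ} (y y' : (geomTB D).Site), 0 ≤ θ → θ ≤ max Θ₁ Θ₂ * (CP * CG / m + U) →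
      θ * ((geomTB D).M)⁻¹ * Real.exp (-(δG / 2 * (geomTB D).dist y y')) ≤
        max Θ₁ Θ₂ * (CP * CG / m + U) * ((geomTB D).M)⁻¹ * Real.exp (-(δG / 2 * (geomTB D).dist y y')) := by
    intro θ y y' hθ hθle
    exact mul_le_mul_of_nonneg_right (mul_le_mul_of_nonneg_right hθle hMinv) (Real.exp_nonneg _)
  by_cases hcc : c = c'
  · -- the diagonal pair: (2.92), `kDiag`
    subst hcc
    have e : kFam Dg (fun c => mulOp (h c)) (fun c => mulOp (ζ c)) Ml Pl c c = kDiag Dg (mulOp (h c)) (mulOp (ζ c)) (Ml c) (Pl c) := by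
      simp [kFam]
    rw [e]
    have hζabs : ∀ x, |ζ c x| ≤ 1 := fun x => abs_le.2 ⟨by linarith [hζ0 c hc x], hζ1 c hc x⟩
    have hhT : ∀ x, h c x ≠ 0 → blk x ∈ T c := fun x hx => hST c hc (hhS c hc x hx)
    have key := hdiag D hMh hP hR hMi2 blk Dg hCG hC₁ hCN hCD hcD hs hs₁ hs₂ hr₀ (DE c) (DK c) (hdec c hc) (hG c hc) (hGout c hc) (hEG c hc)
      (hcf c hc) (hcfT c hc) (hc₀ c hc) (hc₀T c hc) (hh1 c hc) hhT (hLip c hc) (hN c hc) (hz c hc) (hPl c hc) hζabs (hD3 c hc)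
    refine hasMajorant_mono _ key fun y y' => ?_
    have hUc : (((DE c).card : ℝ) * (s₁ * C₁) + s₂ * CG + ((DK c).card + 1) * s * ((CN + 1) * CG * (1 + r₀)) + CD * CG / cD) ≤ U := by
      have h1 : ((DE c).card : ℝ) ≤ nE := by exact_mod_cast hnE c hc
      have h2 : ((DK c).card : ℝ) ≤ nK := by exact_mod_cast hnK c hc
      have h3 : 0 ≤ s₁ * C₁ := by positivity
      have h4 : 0 ≤ s * ((CN + 1) * CG * (1 + r₀)) := by positivity
      rw [hU]; nlinarith
    have hUc0 : 0 ≤ (((DE c).card : ℝ) * (s₁ * C₁) + s₂ * CG + ((DK c).card + 1) * s * ((CN + 1) * CG * (1 + r₀)) + CD * CG / cD) := by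
      positivity
    have h1 : Real.exp (-(δG / 2 * (geomTB D).dist y y')) = Real.exp (-(δG / 2 * (geomTB D).dist y y')) := rfl
    refine hdom y y' (mul_nonneg hΘ₂ hUc0) ?_
    calc Θ₂ * (((DE c).card : ℝ) * (s₁ * C₁) + s₂ * CG + ((DK c).card + 1) * s * ((CN + 1) * CG * (1 + r₀)) + CD * CG / cD)
        ≤ max Θ₁ Θ₂ * U := mul_le_mul (le_max_right _ _) hUc hUc0 (le_max_of_le_left hΘ₁)
      _ ≤ max Θ₁ Θ₂ * (CP * CG / m + U) := mul_le_mul_of_nonneg_left (by linarith) (le_max_of_le_left hΘ₁)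
  · -- an off-diagonal pair: (2.93), `kOff`
    have e : kFam Dg (fun c => mulOp (h c)) (fun c => mulOp (ζ c)) Ml Pl c c' = kOff Dg (mulOp (h c)) (mulOp (ζ c')) (mulOp (h c')) := by
      simp [kFam, hcc]
    rw [e]
    have hGS : LocalMajorant blk (G c') (S c') (fun y y' => CG * (geomTB D).len y ^ 2 * Real.exp (-(δG * (geomTB D).dist y y'))) :=
      localMajorant_subset _ (hG c' hc') (hST c' hc')
    have key := hoff D hMh hP hR hMi1 blk hCP hCG hm (Dg := Dg) (Gl := G c') hDg hGS (hh1 c hc) (hζ0 c' hc') (hζ1 c' hc') (hζS c' hc') (hh1 c' hc')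
      (hhS c' hc') (hgap c' hc')
    refine hasMajorant_mono _ key fun y y' => ?_
    have e2 : Θ₁ * CP * CG / m * ((geomTB D).M)⁻¹ = Θ₁ * (CP * CG / m) * ((geomTB D).M)⁻¹ := by ring
    rw [e2]
    refine hdom y y' (mul_nonneg hΘ₁ hCGm) ?_
    calc Θ₁ * (CP * CG / m) ≤ max Θ₁ Θ₂ * (CP * CG / m) := mul_le_mul_of_nonneg_right (le_max_left _ _) hCGm
      _ ≤ max Θ₁ Θ₂ * (CP * CG / m + U) := mul_le_mul_of_nonneg_left (by linarith) (le_max_of_le_left hΘ₁)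

/-! ## §2  The inputs `h2134` + `hsmall` of the gluing on the torus, above ONE threshold -/

/-- **THE INPUTS `h2134` AND `hsmall` OF `…B6Prop26Gluing.prop26_2136_of_2133_2134` ON THE GENUINE MULTI-LEVEL TORUS, ABOVE ONE THRESHOLD**: for `δ_G > 0`, `C_P ≥ 0`,
constants `C_G, C₁, C_N, C_D, s, s₁, s₂, r₀ ≥ 0`, `c_D, m > 0`, sizes `n_E, n_K`, an overlap number `N` and a walk constant `c₁ ≥ 0` there are `M₁`,
`Θ ≥ 0` such that every family with `L·M_h ≥ M₁` has BOTH `N²θ₀c₁ < 1` AND, for every cube family with the data of `h2134_kFam_torus`, the majorant `θ₀e^{−(δ_G/2)d}`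
of `(K_{□,□′}G_{□′})·h_{□′}` for ALL pairs, `θ₀ = Θ·(C_PC_G/m + U)/M` (with `hR` := `rOp_eq_sum`, `hKout` := `outLoc_kFam`).
[cite: Balaban1984PropagatorsII, (2.134)–(2.135) p.247; Prop. 2.6 p.247; (2.91) p.239] -/
theorem inputs2134_kFam_torus (d ℓ : ℕ) {δG CP CG C₁ CN CD cD s s₁ s₂ r₀ m c₁ : ℝ} (nE nK Nov : ℕ) (hδG : 0 < δG) (hCP : 0 ≤ CP)
    (hCG : 0 ≤ CG) (hC₁ : 0 ≤ C₁) (hCN : 0 ≤ CN) (hCD : 0 ≤ CD) (hcD : 0 < cD) (hs : 0 ≤ s) (hs₁ : 0 ≤ s₁) (hs₂ : 0 ≤ s₂) (hr₀ : 0 ≤ r₀)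
    (hm : 0 < m) (hc₁ : 0 ≤ c₁) :
    ∃ M₁ Θ : ℝ, 0 < M₁ ∧ 0 ≤ Θ ∧
      ∀ {Mh k R : ℕ} {P : Fin (d + 1) → ℕ} (D : TDomains d ℓ Mh k P R), 1 ≤ Mh → (∀ μ, 1 ≤ P μ) → 2 * (ℓ + 1) ≤ R →
        M₁ ≤ ((ℓ : ℝ) + 1) * Mh →
        (Nov : ℝ) ^ 2 * (Θ * (CP * CG / m + (nE * (s₁ * C₁) + s₂ * CG + (nK + 1) * s * ((CN + 1) * CG * (1 + r₀)) + CD * CG / cD)) *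
            ((geomTB D).M)⁻¹) * c₁ < 1 ∧
        ∀ {X : Type} (blk : X → (geomTB D).Site) {Dg : Module.End ℝ (X → ℝ)},
          HasMajorant blk Dg (fun y y'' => CP / (geomTB D).len y ^ 2 * Real.exp (-(δG * (geomTB D).dist y y''))) →
        ∀ {C : Type} [DecidableEq C] (Dc : Finset C) {G Ml Pl : C → Module.End ℝ (X → ℝ)} {h ζ c₀ : C → X → ℝ}
          {T S Score : C → Set (geomTB D).Site}
          {ι : Type} {DE : C → Finset ι} {E : C → ι → Module.End ℝ (X → ℝ)} {cf : C → ι → X → ℝ}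
          {κ : Type} {DK : C → Finset κ} {N : C → κ → Module.End ℝ (X → ℝ)} {z : C → κ → X → ℝ},
          (∀ c ∈ Dc, (DE c).card ≤ nE) → (∀ c ∈ Dc, (DK c).card ≤ nK) →
          (∀ c ∈ Dc, mulOp (h c) * Ml c - Ml c * mulOp (h c) =
            (∑ e ∈ DE c, mulOp (cf c e) * E c e - mulOp (c₀ c)) + ∑ k ∈ DK c, mulOp (z c k) * (N c k * mulOp (h c) - mulOp (h c) * N c k)) →
          (∀ c ∈ Dc, LocalMajorant blk (G c) (T c) (fun y y' => CG * (geomTB D).len y ^ 2 * Real.exp (-(δG * (geomTB D).dist y y')))) →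
          (∀ c ∈ Dc, OutLoc blk (G c) (T c)) →
          (∀ c ∈ Dc, ∀ e ∈ DE c,
            LocalMajorant blk (E c e * G c) (T c) (fun y y' => C₁ * (geomTB D).len y * Real.exp (-(δG * (geomTB D).dist y y')))) →
          (∀ c ∈ Dc, ∀ e ∈ DE c, ∀ x, |cf c e x| ≤ s₁ / ((geomTB D).M * (geomTB D).len (blk x))) →
          (∀ c ∈ Dc, ∀ e ∈ DE c, ∀ x, cf c e x ≠ 0 → blk x ∈ T c) →
          (∀ c ∈ Dc, ∀ x, |c₀ c x| ≤ s₂ / ((geomTB D).M * (geomTB D).len (blk x) ^ 2)) → (∀ c ∈ Dc, ∀ x, c₀ c x ≠ 0 → blk x ∈ T c) →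
          (∀ c ∈ Dc, ∀ x, |h c x| ≤ 1) → (∀ c ∈ Dc, ∀ x, h c x ≠ 0 → blk x ∈ S c) → (∀ c ∈ Dc, S c ⊆ T c) →
          (∀ c ∈ Dc, ∀ x x', |h c x' - h c x| ≤ s / (geomTB D).M * ((geomTB D).dist (blk x) (blk x') + r₀)) →
          (∀ c ∈ Dc, ∀ k ∈ DK c,
            HasMajorant blk (N c k) (fun y y'' => CN / (geomTB D).len y ^ 2 * Real.exp (-(δG * (geomTB D).dist y y'')))) →
          (∀ c ∈ Dc, ∀ k ∈ DK c, ∀ x, |z c k x| ≤ 1) →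
          (∀ c ∈ Dc, HasMajorant blk (Pl c) (fun y y'' => CN / (geomTB D).len y ^ 2 * Real.exp (-(δG * (geomTB D).dist y y'')))) →
          (∀ c ∈ Dc, ∀ x, 0 ≤ ζ c x) → (∀ c ∈ Dc, ∀ x, ζ c x ≤ 1) → (∀ c ∈ Dc, ∀ x, ζ c x ≠ 1 → blk x ∉ Score c) →
          (∀ c ∈ Dc, HasMajorant blk (mulOp (ζ c) * (Dg - Pl c) * mulOp (h c))
            (fun y y'' => CD * Real.exp (-(cD * (geomTB D).M)) / (geomTB D).len y ^ 2 * Real.exp (-(δG * (geomTB D).dist y y'')))) →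
          (∀ c ∈ Dc, ∀ y y'', y ∉ Score c → y'' ∈ S c → m * (geomTB D).M ≤ (geomTB D).dist y y'') →
          ∀ c ∈ Dc, ∀ c' ∈ Dc,
            HasMajorant blk
              ((kFam Dg (fun c => mulOp (h c)) (fun c => mulOp (ζ c)) Ml Pl c c' * G c') * mulOp (h c'))
              (fun y y' => Θ * (CP * CG / m + (nE * (s₁ * C₁) + s₂ * CG + (nK + 1) * s * ((CN + 1) * CG * (1 + r₀)) + CD * CG / cD)) *
                ((geomTB D).M)⁻¹ * Real.exp (-(δG / 2 * (geomTB D).dist y y'))) := by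
  obtain ⟨M₀, Θ, hM₀, hΘ, hall⟩ := h2134_kFam_torus d ℓ hδG
  have hV : 0 ≤ CP * CG / m + (nE * (s₁ * C₁) + s₂ * CG + (nK + 1) * s * ((CN + 1) * CG * (1 + r₀)) + CD * CG / cD) := by
    have := div_nonneg (mul_nonneg hCP hCG) hm.le
    positivity
  obtain ⟨M₂, hM₂, hsmall⟩ := theta0_joint_lt (Θ := Θ) Nov hΘ hV hc₁
  refine ⟨max M₀ M₂, Θ, lt_max_of_lt_left hM₀, hΘ, fun D hMh hP hR hM => ⟨?_, ?_⟩⟩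
  · have hMD : M₂ ≤ (geomTB D).M := by rw [geomTB_M]; exact (le_max_right _ _).trans hM
    exact hsmall _ hMD
  · intro X blk Dg hDg C _ Dc G Ml Pl h ζ c₀ T S Score ι DE E cf κ DK N z hnE hnK hdec hG hGout hEG hcf hcfT hc₀ hc₀T hh1 hhS hST hLip hN hz hPl
      hζ0 hζ1 hζS hD3 hgap
    exact hall D hMh hP hR ((le_max_left _ _).trans hM) blk hCP hDg hCG hC₁ hCN hCD hcD hs hs₁ hs₂ hr₀ hm nE nK Dc hnE hnK hdec hG hGout hEG hcf
      hcfT hc₀ hc₀T hh1 hhS hST hLip hN hz hPl hζ0 hζ1 hζS hD3 hgap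

end Literature.MathematicalPhysics.QuantumFieldTheory.Balaban1983to89.B6Ineq2134KFamKLevelTorus
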